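import Summits.Ventures.YMGap.Thresholds.CouplingDerivative
import Summits.Ventures.YMGap.Thresholds.CouplingDerivativeSUN
import Summits.Ventures.YMGap.Thresholds.CouplingDerivativeDim
import HarnessLib

/-!
# Venture YMGap — C-DIFF ON THE CLOSED WINDOW: one-sided derivatives at the endpoints (in particular at `β = 0⁺`, the
# strong-coupling end) — `HasDerivWithinAt` within `[0, β₁]` at every point of the closed window

HONEST FRAMING: venture file of the cell `pub-ymgap` (QuantumFields programme), seat ds-1; endpoint form of `CouplingDerivative` /
`CouplingDerivativeSUN` / `CouplingDerivativeDim`.  The integrated fluctuation–response formula holds on the CLOSED window and the response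
series is continuous there, so the FTC at a point of the closed interval (Mathlib `FTCFilter.nhdsIcc`) gives the derivative WITHIN `[0, β₁]`
at every `β ∈ [0, β₁]`: the right derivative at `β = 0` (where the DLR state is the `β = 0` state of the specification) and the left
derivative at `β₁`.  The VALUE of the response series at `β = 0` (for `SU(2)`: `Var_Haar(W_p) = 1/4` for `F = W_p`, the leading
Balian–Drouffe–Itzykson coefficient) is NOT computed here.  Lattice strong coupling; `C¹` only; nothing about the continuum or Clay.

* `hasDerivWithinAt_of_intervalIntegral_eq` — calculus: `∫_a^t g = Φ t − Φ a` on `[a, c]`, `g` continuous on `[a, c]` ⇒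
  `HasDerivWithinAt Φ (g t₀) (Icc a c) t₀` for every `t₀ ∈ [a, c]`;
* `su2_hasDerivWithinAt_integral_star` / `_9_25` — `SU(2)`, `d = 4`, every `β_W ∈ [0, β₁]`, `β₁ ≤ 9/25`;
* `hasDerivWithinAt_integral_SU_thooft` — every `SU(N)`, `N ≥ 2`, `d = 4`, every `b ∈ [0, N·9/308]`;
* `hasDerivWithinAt_integral_dim_thooft` — every `SU(N)`, `N ≥ 2`, every `d ≥ 2`, every `b ∈ [0, N/(12(d−1))]`.
-/

noncomputable section

open MeasureTheory ProbabilityTheory Set Filter Topology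
open scoped NNReal
open Literature.MathematicalPhysics.QuantumLattice (LGConfig ZdEdge ZdPlaquette fundamentalRep ymGibbsMeasures)
open Literature.MathematicalPhysics.QuantumFieldTheory hiding ZdEdge
open Literature.MathematicalPhysics.QuantumFieldTheory.Balaban1983to89.StrongCouplingKernelWindow (oneLinkKRModulus_SU)

namespace Summit.Ventures.YMGap.CouplingResponse

variable {d N : ℕ}

/-- **FTC at a point of a closed interval**: if `∫_a^t g = Φ t − Φ a` for all `t ∈ [a, c]` and `g` is continuous on `[a, c]`, then
`Φ` has derivative `g t₀` WITHIN `[a, c]` at every `t₀ ∈ [a, c]` (endpoints included). [folklore] -/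
theorem hasDerivWithinAt_of_intervalIntegral_eq {Φ g : ℝ → ℝ} {a c : ℝ}
    (hint : ∀ t ∈ Icc a c, ∫ u in a..t, g u = Φ t - Φ a) (hg : ContinuousOn g (Icc a c))
    {t₀ : ℝ} (ht₀ : t₀ ∈ Icc a c) : HasDerivWithinAt Φ (g t₀) (Icc a c) t₀ := by
  haveI : Fact (t₀ ∈ Icc a c) := ⟨ht₀⟩
  have hgi : IntervalIntegrable g volume a t₀ :=
    (hg.mono (uIcc_subset_Icc (left_mem_Icc.2 (ht₀.1.trans ht₀.2)) ht₀)).intervalIntegrable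
  have hmeas : StronglyMeasurableAtFilter g (𝓝[Icc a c] t₀) volume :=
    hg.stronglyMeasurableAtFilter_nhdsWithin measurableSet_Icc t₀
  have hcont : ContinuousWithinAt g (Icc a c) t₀ := hg t₀ ht₀
  have h := (intervalIntegral.integral_hasDerivWithinAt_right (s := Icc a c) (t := Icc a c) hgi hmeas hcont).const_add (Φ a)
  refine h.congr_of_eventuallyEq ?_ ?_
  · filter_upwards [self_mem_nhdsWithin] with t ht
    rw [hint t ht]; ring
  · rw [hint t₀ ht₀]; ring

/-- ★ **`SU(2)`, `d = 4`: the fluctuation–response formula on the CLOSED window** — for `β₁ ≤ 9/25`, any DLR selection `μ` on `[0, β₁]`,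
every Lipschitz cylinder `F` and every `β_W ∈ [0, β₁]`:
`HasDerivWithinAt (β ↦ ⟨F⟩_{μ β}) (Σ_q Cov_{μ β_W}(F, W_q)) [0, β₁] β_W` (at `β_W = 0` the right derivative at the `β = 0` state). [folklore] -/
theorem su2_hasDerivWithinAt_integral_star {β₁ : ℝ} (h1 : β₁ ≤ 9 / 25)
    {μ : ℝ → Measure (LGConfig 4 (Matrix.specialUnitaryGroup (Fin 2) ℂ))}
    (hμ : ∀ βW ∈ Icc (0 : ℝ) β₁, μ βW ∈ ymGibbsMeasures (d := 4) (fundamentalRep (Fin 2)) (2 * (βW / 4)))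
    {F : LGConfig 4 (Matrix.specialUnitaryGroup (Fin 2) ℂ) → ℝ} {Λ : Finset (ZdEdge 4)} {K : ℝ≥0}
    (hF : IsLipschitzCylinder (fundamentalRep (Fin 2)) F Λ K)
    {x₀ : Literature.Probability.LatticeModels.Site 4} {D : ℕ} (hD : ∀ e ∈ Λ, ‖e.1 - x₀‖ ≤ D)
    {βW : ℝ} (hb : βW ∈ Icc (0 : ℝ) β₁) :
    HasDerivWithinAt (fun t => ∫ U, F U ∂(μ t))
      (∑' q : ZdPlaquette 4, cov[F, zdPlaquetteObs (fundamentalRep (Fin 2)) q.1 q.2.1.1 q.2.1.2; μ βW]) (Icc (0 : ℝ) β₁) βW := by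
  have hβ₁0 : 0 ≤ β₁ := hb.1.trans hb.2
  exact hasDerivWithinAt_of_intervalIntegral_eq
    (fun t ht => su2_integral_sub_eq_intervalIntegral h1 hμ hF hD (left_mem_Icc.2 hβ₁0) ht)
    (su2_continuousOn_responseSum h1 hμ hF hD) hb

/-- ★ **The instance `β₁ = 9/25`**: within-derivative at every `β_W ∈ [0, 9/25]`, including the right derivative at `β_W = 0`. [folklore] -/
theorem su2_hasDerivWithinAt_integral_9_25
    {μ : ℝ → Measure (LGConfig 4 (Matrix.specialUnitaryGroup (Fin 2) ℂ))}
    (hμ : ∀ βW ∈ Icc (0 : ℝ) (9 / 25), μ βW ∈ ymGibbsMeasures (d := 4) (fundamentalRep (Fin 2)) (2 * (βW / 4)))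
    {F : LGConfig 4 (Matrix.specialUnitaryGroup (Fin 2) ℂ) → ℝ} {Λ : Finset (ZdEdge 4)} {K : ℝ≥0}
    (hF : IsLipschitzCylinder (fundamentalRep (Fin 2)) F Λ K)
    {x₀ : Literature.Probability.LatticeModels.Site 4} {D : ℕ} (hD : ∀ e ∈ Λ, ‖e.1 - x₀‖ ≤ D)
    {βW : ℝ} (hb : βW ∈ Icc (0 : ℝ) (9 / 25)) :
    HasDerivWithinAt (fun t => ∫ U, F U ∂(μ t))
      (∑' q : ZdPlaquette 4, cov[F, zdPlaquetteObs (fundamentalRep (Fin 2)) q.1 q.2.1.1 q.2.1.2; μ βW]) (Icc (0 : ℝ) (9 / 25)) βW :=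
  su2_hasDerivWithinAt_integral_star le_rfl hμ hF hD hb

/-- ★ **Every `SU(N)`, `N ≥ 2`, `d = 4`: within-derivative on the closed window `[0, N·9/308]`** (hypothesis-free):
`HasDerivWithinAt (b ↦ ⟨F⟩_{μ b}) (N·Σ_q Cov_{μ b}(F, W_q)) [0, N·9/308] b`. [folklore] -/
theorem hasDerivWithinAt_integral_SU_thooft (hN : 2 ≤ N)
    {μ : ℝ → Measure (LGConfig 4 (Matrix.specialUnitaryGroup (Fin N) ℂ))}
    (hμ : ∀ b ∈ Icc (0 : ℝ) ((N : ℝ) * (9 / 308)), μ b ∈ ymGibbsMeasures (d := 4) (fundamentalRep (Fin N)) b)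
    {F : LGConfig 4 (Matrix.specialUnitaryGroup (Fin N) ℂ) → ℝ} {Λ : Finset (ZdEdge 4)} {KF : ℝ≥0}
    (hF : IsLipschitzCylinder (fundamentalRep (Fin N)) F Λ KF)
    {x₀ : Literature.Probability.LatticeModels.Site 4} {D : ℕ} (hD : ∀ e ∈ Λ, ‖e.1 - x₀‖ ≤ D)
    {b : ℝ} (hb : b ∈ Icc (0 : ℝ) ((N : ℝ) * (9 / 308))) :
    HasDerivWithinAt (fun t => ∫ U, F U ∂(μ t))
      ((N : ℝ) * ∑' q : ZdPlaquette 4, cov[F, zdPlaquetteObs (fundamentalRep (Fin N)) q.1 q.2.1.1 q.2.1.2; μ b])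
      (Icc (0 : ℝ) ((N : ℝ) * (9 / 308))) b := by
  have hN0 : (0 : ℝ) < N := by exact_mod_cast (show 0 < N by omega)
  set b₁ : ℝ := (N : ℝ) * (9 / 308) with hb₁
  have hb₁N : b₁ / N = 9 / 308 := by rw [hb₁]; field_simp
  have hb₁0 : 0 ≤ b₁ := by positivity
  obtain ⟨h1', hK0, h4⟩ := StarSUN.bakryEmery_coef_le (by omega) hb₁0 hb₁N.le
  have hab : |b₁| / N = b₁ / N := by rw [abs_of_nonneg hb₁0]
  rw [hab] at h1' hK0 h4
  have hmod := oneLinkKRModulus_SU hN h1'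
  exact hasDerivWithinAt_of_intervalIntegral_eq
    (g := fun t => (N : ℝ) * ∑' q : ZdPlaquette 4, cov[F, zdPlaquetteObs (fundamentalRep (Fin N)) q.1 q.2.1.1 q.2.1.2; μ t])
    (fun t ht => integral_sub_eq_intervalIntegral_SU (by omega) hK0 hmod le_rfl h4 hμ hF hD (left_mem_Icc.2 hb₁0) ht)
    (continuousOn_const.mul (continuousOn_responseSum_SU (by omega) hK0 hmod le_rfl h4 hμ hF hD)) hb

/-- ★ **Every `SU(N)`, `N ≥ 2`, every `d ≥ 2`: within-derivative on the closed window `[0, N/(12(d−1))]`** (hypothesis-free).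
[folklore] -/
theorem hasDerivWithinAt_integral_dim_thooft (hd : 2 ≤ d) (hN : 2 ≤ N)
    {μ : ℝ → Measure (LGConfig d (Matrix.specialUnitaryGroup (Fin N) ℂ))}
    (hμ : ∀ b ∈ Icc (0 : ℝ) ((N : ℝ) / (12 * ((d : ℝ) - 1))), μ b ∈ ymGibbsMeasures (d := d) (fundamentalRep (Fin N)) b)
    {F : LGConfig d (Matrix.specialUnitaryGroup (Fin N) ℂ) → ℝ} {Λ : Finset (ZdEdge d)} {KF : ℝ≥0}
    (hF : IsLipschitzCylinder (fundamentalRep (Fin N)) F Λ KF)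
    {x₀ : Literature.Probability.LatticeModels.Site d} {D : ℕ} (hD : ∀ e ∈ Λ, ‖e.1 - x₀‖ ≤ D)
    {b : ℝ} (hb : b ∈ Icc (0 : ℝ) ((N : ℝ) / (12 * ((d : ℝ) - 1)))) :
    HasDerivWithinAt (fun t => ∫ U, F U ∂(μ t))
      ((N : ℝ) * ∑' q : ZdPlaquette d, cov[F, zdPlaquetteObs (fundamentalRep (Fin N)) q.1 q.2.1.1 q.2.1.2; μ b])
      (Icc (0 : ℝ) ((N : ℝ) / (12 * ((d : ℝ) - 1)))) b := by
  have hβ₁0 : (0 : ℝ) ≤ (N : ℝ) / (12 * ((d : ℝ) - 1)) := hb.1.trans hb.2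
  obtain ⟨h1', hK0, hdoor⟩ := bakryEmery_door_dim (N := N) hd (by omega)
  exact hasDerivWithinAt_of_intervalIntegral_eq
    (g := fun t => (N : ℝ) * ∑' q : ZdPlaquette d, cov[F, zdPlaquetteObs (fundamentalRep (Fin N)) q.1 q.2.1.1 q.2.1.2; μ t])
    (fun t ht => integral_sub_eq_intervalIntegral_dim hd (by omega) hK0 (oneLinkKRModulus_SU hN h1') le_rfl hdoor hμ hF hD
      (left_mem_Icc.2 hβ₁0) ht)
    (continuousOn_const.mul (continuousOn_responseSum_dim hd (by omega) hK0 (oneLinkKRModulus_SU hN h1') le_rfl hdoor hμ hF hD)) hb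

end Summit.Ventures.YMGap.CouplingResponse

end
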